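import Mathlib
import Summits.Ventures.PercRepro2.HCov
import Summits.Ventures.PercRepro2.EdgeCubic
import Summits.Ventures.PercRepro2.PendantA3Pins

/-!
# A pendant edge of `a₃`: the twelve masses of `EdgeLine.B1` / `B2` at each pin, collected
(blind cell PercRepro2, p5 g15; `proofs/P5-OEDGE.md` §16)

`pins_zero_pendant`: at `p[f↦0]` the leaf `a₃` is isolated — `D = P(Q)`, `D_o = P(Q, o ∈ U)`, every
`σ₃`-mass vanishes, `PDb`, `PDbo` are the `Q`-masses of `b`, the `(b, o)`-masses and `gap` are unchanged;
`pins_one_pendant`: at `p[f↦1]` the leaf is identified with `u` — every mass is the mass of the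
instance with `a₃ := u`. Both from the `prob_zero_*` / `prob_one_*` lemmas of PendantA3Pins.lean.
-/

namespace Summit.Ventures.PercRepro2

open UnionCluster CovForm PendantRoot

namespace PendantA3

/-! ## The twelve masses at each pin, collected -/

section Pins

variable {V : Type*} {E : Type*} [Fintype E] [DecidableEq E] {R : Type*} [Field R]
  [LinearOrder R] [IsStrictOrderedRing R]

/-- The twelve masses of `B1` / `B2` at the pin `p[f↦0]` of a pendant edge: the leaf is isolated. -/
theorem pins_zero_pendant (p : E → R) {ends : E → Sym2 V} {f : E} {o a₁ a₂ a₃ b u : V}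
    (hf : ends f = s(a₃, u)) (hleaf : ∀ e, a₃ ∈ ends e → e = f) (h3u : a₃ ≠ u) (h13 : a₁ ≠ a₃)
    (h23 : a₂ ≠ a₃) (ho3 : o ≠ a₃) (hb3 : b ≠ a₃) :
    prob (Function.update p f 0) (avoidAll ends a₂ {a₁}) = prob p (avoidAll ends a₂ {a₁}) ∧
    prob (Function.update p f 0) (PDEvent ends a₁ a₂ a₃) = prob p (avoidAll ends a₂ {a₁}) ∧
    Do (Function.update p f 0) ends o a₁ a₂ a₃ =
      prob p (avoidAll ends a₂ {a₁} ∩ connEvent ends a₁ o) +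
        prob p (avoidAll ends a₂ {a₁} ∩ connEvent ends a₂ o) ∧
    EQbo (Function.update p f 0) ends o a₁ a₂ b = EQbo p ends o a₁ a₂ b ∧
    EQb3 (Function.update p f 0) ends a₁ a₂ a₃ b = 0 ∧
    EQb3o (Function.update p f 0) ends o a₁ a₂ a₃ b = 0 ∧
    EQo (Function.update p f 0) ends o a₁ a₂ = EQo p ends o a₁ a₂ ∧
    EQ3 (Function.update p f 0) ends a₁ a₂ a₃ = 0 ∧
    EQ3o (Function.update p f 0) ends o a₁ a₂ a₃ = 0 ∧
    PDb (Function.update p f 0) ends a₁ a₂ a₃ b =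
      prob p (avoidAll ends a₂ {a₁} ∩ connEvent ends a₁ b) +
        prob p (avoidAll ends a₂ {a₁} ∩ connEvent ends a₂ b) ∧
    PDbo (Function.update p f 0) ends o a₁ a₂ a₃ b =
      prob p (avoidAll ends a₂ {a₁} ∩ (connEvent ends a₁ o ∩ connEvent ends a₁ b)) +
        prob p (avoidAll ends a₂ {a₁} ∩ (connEvent ends a₂ o ∩ connEvent ends a₁ b)) +
        prob p (avoidAll ends a₂ {a₁} ∩ (connEvent ends a₁ o ∩ connEvent ends a₂ b)) +
        prob p (avoidAll ends a₂ {a₁} ∩ (connEvent ends a₂ o ∩ connEvent ends a₂ b)) ∧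
    gap (Function.update p f 0) ends a₁ a₂ b = gap p ends a₁ a₂ b := by
  have funiv : Free f (Set.univ : Set (Config E)) := fun _ _ _ => by simp
  have fo1 : Free f (connEvent ends a₁ o) := free_connEvent hf hleaf h3u h13 ho3
  have fo2 : Free f (connEvent ends a₂ o) := free_connEvent hf hleaf h3u h23 ho3
  have fb1 : Free f (connEvent ends a₁ b) := free_connEvent hf hleaf h3u h13 hb3
  have fb2 : Free f (connEvent ends a₂ b) := free_connEvent hf hleaf h3u h23 hb3
  have f11 : Free f (connEvent ends a₁ o ∩ connEvent ends a₁ b) := fo1.inter fb1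
  have f22 : Free f (connEvent ends a₂ o ∩ connEvent ends a₂ b) := fo2.inter fb2
  have f21 : Free f (connEvent ends a₂ o ∩ connEvent ends a₁ b) := fo2.inter fb1
  have f12 : Free f (connEvent ends a₁ o ∩ connEvent ends a₂ b) := fo1.inter fb2
  -- pin 0: the leaf is isolated
  have hQ0 : prob (Function.update p f 0) (avoidAll ends a₂ {a₁}) = prob p (avoidAll ends a₂ {a₁}) := by
    have := prob_zero_Q p a₁ a₂ hf hleaf h3u h13 h23 funiv; simpa only [Set.inter_univ] using this
  have hD0 : prob (Function.update p f 0) (PDEvent ends a₁ a₂ a₃) = prob p (avoidAll ends a₂ {a₁}) := by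
    have := prob_zero_PD p a₁ a₂ hf hleaf h3u h13 h23 funiv; simpa only [Set.inter_univ] using this
  have hT0 : prob (Function.update p f 0) (TEvent ends a₁ a₂ a₃) = 0 := by
    have := prob_zero_T p a₁ a₂ hf hleaf h3u h23 Set.univ; simpa only [Set.inter_univ] using this
  have hT'0 : prob (Function.update p f 0) (TEvent ends a₂ a₁ a₃) = 0 := by
    have := prob_zero_T' p a₁ a₂ hf hleaf h3u h13 Set.univ; simpa only [Set.inter_univ] using this
  have hDo0 : Do (Function.update p f 0) ends o a₁ a₂ a₃ =
      prob p (avoidAll ends a₂ {a₁} ∩ connEvent ends a₁ o) + prob p (avoidAll ends a₂ {a₁} ∩ connEvent ends a₂ o) := by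
    unfold Do; rw [prob_zero_PD p a₁ a₂ hf hleaf h3u h13 h23 fo1, prob_zero_PD p a₁ a₂ hf hleaf h3u h13 h23 fo2]
  have hEQbo0 : EQbo (Function.update p f 0) ends o a₁ a₂ b = EQbo p ends o a₁ a₂ b := by
    unfold EQbo; rw [prob_zero_Q p a₁ a₂ hf hleaf h3u h13 h23 f11, prob_zero_Q p a₁ a₂ hf hleaf h3u h13 h23 f22, prob_zero_Q p a₁ a₂ hf hleaf h3u h13 h23 f21, prob_zero_Q p a₁ a₂ hf hleaf h3u h13 h23 f12]
  have hEQb3_0 : EQb3 (Function.update p f 0) ends a₁ a₂ a₃ b = 0 := by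
    unfold EQb3; simp only [prob_zero_T p a₁ a₂ hf hleaf h3u h23, prob_zero_T' p a₁ a₂ hf hleaf h3u h13, add_zero, sub_zero]
  have hEQb3o0 : EQb3o (Function.update p f 0) ends o a₁ a₂ a₃ b = 0 := by
    unfold EQb3o; simp only [prob_zero_T p a₁ a₂ hf hleaf h3u h23, prob_zero_T' p a₁ a₂ hf hleaf h3u h13, add_zero, sub_zero]
  have hEQo0 : EQo (Function.update p f 0) ends o a₁ a₂ = EQo p ends o a₁ a₂ := by
    unfold EQo; rw [prob_zero_Q p a₁ a₂ hf hleaf h3u h13 h23 fo1, prob_zero_Q p a₁ a₂ hf hleaf h3u h13 h23 fo2]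
  have hEQ3_0 : EQ3 (Function.update p f 0) ends a₁ a₂ a₃ = 0 := by
    unfold EQ3; rw [hT0, hT'0]; ring
  have hEQ3o0 : EQ3o (Function.update p f 0) ends o a₁ a₂ a₃ = 0 := by
    unfold EQ3o; simp only [prob_zero_T p a₁ a₂ hf hleaf h3u h23, prob_zero_T' p a₁ a₂ hf hleaf h3u h13, add_zero, sub_zero]
  have hPDb0 : PDb (Function.update p f 0) ends a₁ a₂ a₃ b =
      prob p (avoidAll ends a₂ {a₁} ∩ connEvent ends a₁ b) + prob p (avoidAll ends a₂ {a₁} ∩ connEvent ends a₂ b) := by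
    unfold PDb; rw [prob_zero_PD p a₁ a₂ hf hleaf h3u h13 h23 fb1, prob_zero_PD p a₁ a₂ hf hleaf h3u h13 h23 fb2]
  have hPDbo0 : PDbo (Function.update p f 0) ends o a₁ a₂ a₃ b =
      prob p (avoidAll ends a₂ {a₁} ∩ (connEvent ends a₁ o ∩ connEvent ends a₁ b)) +
        prob p (avoidAll ends a₂ {a₁} ∩ (connEvent ends a₂ o ∩ connEvent ends a₁ b)) +
        prob p (avoidAll ends a₂ {a₁} ∩ (connEvent ends a₁ o ∩ connEvent ends a₂ b)) +
        prob p (avoidAll ends a₂ {a₁} ∩ (connEvent ends a₂ o ∩ connEvent ends a₂ b)) := by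
    unfold PDbo; rw [prob_zero_PD p a₁ a₂ hf hleaf h3u h13 h23 f11, prob_zero_PD p a₁ a₂ hf hleaf h3u h13 h23 f21, prob_zero_PD p a₁ a₂ hf hleaf h3u h13 h23 f12, prob_zero_PD p a₁ a₂ hf hleaf h3u h13 h23 f22]
  have hgap0 : gap (Function.update p f 0) ends a₁ a₂ b = gap p ends a₁ a₂ b := by
    rw [gap_eq_Q, gap_eq_Q, prob_zero_Q p a₁ a₂ hf hleaf h3u h13 h23 fb2, prob_zero_Q p a₁ a₂ hf hleaf h3u h13 h23 fb1]
  exact ⟨hQ0, hD0, hDo0, hEQbo0, hEQb3_0, hEQb3o0, hEQo0, hEQ3_0, hEQ3o0, hPDb0, hPDbo0, hgap0⟩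

/-- The twelve masses at the pin `p[f↦1]`: the leaf is identified with `u`. -/
theorem pins_one_pendant (p : E → R) {ends : E → Sym2 V} {f : E} {o a₁ a₂ a₃ b u : V}
    (hf : ends f = s(a₃, u)) (hleaf : ∀ e, a₃ ∈ ends e → e = f) (h3u : a₃ ≠ u) (h13 : a₁ ≠ a₃)
    (h23 : a₂ ≠ a₃) (ho3 : o ≠ a₃) (hb3 : b ≠ a₃) :
    prob (Function.update p f 1) (avoidAll ends a₂ {a₁}) = prob p (avoidAll ends a₂ {a₁}) ∧
    prob (Function.update p f 1) (PDEvent ends a₁ a₂ a₃) = prob p (PDEvent ends a₁ a₂ u) ∧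
    Do (Function.update p f 1) ends o a₁ a₂ a₃ = Do p ends o a₁ a₂ u ∧
    EQbo (Function.update p f 1) ends o a₁ a₂ b = EQbo p ends o a₁ a₂ b ∧
    EQb3 (Function.update p f 1) ends a₁ a₂ a₃ b = EQb3 p ends a₁ a₂ u b ∧
    EQb3o (Function.update p f 1) ends o a₁ a₂ a₃ b = EQb3o p ends o a₁ a₂ u b ∧
    EQo (Function.update p f 1) ends o a₁ a₂ = EQo p ends o a₁ a₂ ∧
    EQ3 (Function.update p f 1) ends a₁ a₂ a₃ = EQ3 p ends a₁ a₂ u ∧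
    EQ3o (Function.update p f 1) ends o a₁ a₂ a₃ = EQ3o p ends o a₁ a₂ u ∧
    PDb (Function.update p f 1) ends a₁ a₂ a₃ b = PDb p ends a₁ a₂ u b ∧
    PDbo (Function.update p f 1) ends o a₁ a₂ a₃ b = PDbo p ends o a₁ a₂ u b ∧
    gap (Function.update p f 1) ends a₁ a₂ b = gap p ends a₁ a₂ b := by
  have funiv : Free f (Set.univ : Set (Config E)) := fun _ _ _ => by simp
  have fo1 : Free f (connEvent ends a₁ o) := free_connEvent hf hleaf h3u h13 ho3
  have fo2 : Free f (connEvent ends a₂ o) := free_connEvent hf hleaf h3u h23 ho3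
  have fb1 : Free f (connEvent ends a₁ b) := free_connEvent hf hleaf h3u h13 hb3
  have fb2 : Free f (connEvent ends a₂ b) := free_connEvent hf hleaf h3u h23 hb3
  have f11 : Free f (connEvent ends a₁ o ∩ connEvent ends a₁ b) := fo1.inter fb1
  have f22 : Free f (connEvent ends a₂ o ∩ connEvent ends a₂ b) := fo2.inter fb2
  have f21 : Free f (connEvent ends a₂ o ∩ connEvent ends a₁ b) := fo2.inter fb1
  have f12 : Free f (connEvent ends a₁ o ∩ connEvent ends a₂ b) := fo1.inter fb2
  -- pin 1: the leaf is identified with `u`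
  have hQ1 : prob (Function.update p f 1) (avoidAll ends a₂ {a₁}) = prob p (avoidAll ends a₂ {a₁}) := by
    have := prob_one_Q p a₁ a₂ hf hleaf h3u h13 h23 funiv; simpa only [Set.inter_univ] using this
  have hD1 : prob (Function.update p f 1) (PDEvent ends a₁ a₂ a₃) =
      prob p (PDEvent ends a₁ a₂ u) := by
    have := prob_one_PD p a₁ a₂ hf hleaf h3u h13 h23 funiv; simpa only [Set.inter_univ] using this
  have hT1 : prob (Function.update p f 1) (TEvent ends a₁ a₂ a₃) = prob p (TEvent ends a₁ a₂ u) := by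
    have := prob_one_T p a₁ a₂ hf hleaf h3u h13 h23 funiv; simpa only [Set.inter_univ] using this
  have hT'1 : prob (Function.update p f 1) (TEvent ends a₂ a₁ a₃) =
      prob p (TEvent ends a₂ a₁ u) := by
    have := prob_one_T' p a₁ a₂ hf hleaf h3u h13 h23 funiv; simpa only [Set.inter_univ] using this
  have hDo1 : Do (Function.update p f 1) ends o a₁ a₂ a₃ = Do p ends o a₁ a₂ u := by
    unfold Do; rw [prob_one_PD p a₁ a₂ hf hleaf h3u h13 h23 fo1, prob_one_PD p a₁ a₂ hf hleaf h3u h13 h23 fo2]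
  have hEQbo1 : EQbo (Function.update p f 1) ends o a₁ a₂ b = EQbo p ends o a₁ a₂ b := by
    unfold EQbo; rw [prob_one_Q p a₁ a₂ hf hleaf h3u h13 h23 f11, prob_one_Q p a₁ a₂ hf hleaf h3u h13 h23 f22, prob_one_Q p a₁ a₂ hf hleaf h3u h13 h23 f21, prob_one_Q p a₁ a₂ hf hleaf h3u h13 h23 f12]
  have hEQb3_1 : EQb3 (Function.update p f 1) ends a₁ a₂ a₃ b = EQb3 p ends a₁ a₂ u b := by
    unfold EQb3; rw [prob_one_T' p a₁ a₂ hf hleaf h3u h13 h23 fb1, prob_one_T p a₁ a₂ hf hleaf h3u h13 h23 fb2, prob_one_T p a₁ a₂ hf hleaf h3u h13 h23 fb1, prob_one_T' p a₁ a₂ hf hleaf h3u h13 h23 fb2]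
  have hEQb3o1 : EQb3o (Function.update p f 1) ends o a₁ a₂ a₃ b = EQb3o p ends o a₁ a₂ u b := by
    unfold EQb3o
    simp only [prob_one_T' p a₁ a₂ hf hleaf h3u h13 h23 f11, prob_one_T' p a₁ a₂ hf hleaf h3u h13 h23 f21, prob_one_T p a₁ a₂ hf hleaf h3u h13 h23 f12, prob_one_T p a₁ a₂ hf hleaf h3u h13 h23 f22, prob_one_T p a₁ a₂ hf hleaf h3u h13 h23 f11, prob_one_T p a₁ a₂ hf hleaf h3u h13 h23 f21, prob_one_T' p a₁ a₂ hf hleaf h3u h13 h23 f12,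
      prob_one_T' p a₁ a₂ hf hleaf h3u h13 h23 f22]
  have hEQo1 : EQo (Function.update p f 1) ends o a₁ a₂ = EQo p ends o a₁ a₂ := by
    unfold EQo; rw [prob_one_Q p a₁ a₂ hf hleaf h3u h13 h23 fo1, prob_one_Q p a₁ a₂ hf hleaf h3u h13 h23 fo2]
  have hEQ3_1 : EQ3 (Function.update p f 1) ends a₁ a₂ a₃ = EQ3 p ends a₁ a₂ u := by
    unfold EQ3; rw [hT'1, hT1]
  have hEQ3o1 : EQ3o (Function.update p f 1) ends o a₁ a₂ a₃ = EQ3o p ends o a₁ a₂ u := by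
    unfold EQ3o; simp only [prob_one_T' p a₁ a₂ hf hleaf h3u h13 h23 fo1, prob_one_T' p a₁ a₂ hf hleaf h3u h13 h23 fo2, prob_one_T p a₁ a₂ hf hleaf h3u h13 h23 fo1, prob_one_T p a₁ a₂ hf hleaf h3u h13 h23 fo2]
  have hPDb1 : PDb (Function.update p f 1) ends a₁ a₂ a₃ b = PDb p ends a₁ a₂ u b := by
    unfold PDb; rw [prob_one_PD p a₁ a₂ hf hleaf h3u h13 h23 fb1, prob_one_PD p a₁ a₂ hf hleaf h3u h13 h23 fb2]
  have hPDbo1 : PDbo (Function.update p f 1) ends o a₁ a₂ a₃ b = PDbo p ends o a₁ a₂ u b := by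
    unfold PDbo; simp only [prob_one_PD p a₁ a₂ hf hleaf h3u h13 h23 f11, prob_one_PD p a₁ a₂ hf hleaf h3u h13 h23 f21, prob_one_PD p a₁ a₂ hf hleaf h3u h13 h23 f12, prob_one_PD p a₁ a₂ hf hleaf h3u h13 h23 f22]
  have hgap1 : gap (Function.update p f 1) ends a₁ a₂ b = gap p ends a₁ a₂ b := by
    rw [gap_eq_Q, gap_eq_Q, prob_one_Q p a₁ a₂ hf hleaf h3u h13 h23 fb2, prob_one_Q p a₁ a₂ hf hleaf h3u h13 h23 fb1]
  exact ⟨hQ1, hD1, hDo1, hEQbo1, hEQb3_1, hEQb3o1, hEQo1, hEQ3_1, hEQ3o1, hPDb1, hPDbo1, hgap1⟩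

end Pins

end PendantA3

end Summit.Ventures.PercRepro2
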